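import Literature.NumberTheory.LocalFields.UnramifiedQuadraticNormSurjective    -- ★ §1 `exists_mul_map_eq_of_sub_mem` (a σ-fixed unit which is a norm mod `I` is a norm), `map_mem_maximalIdeal`; transitively ★ `HermitianFormsHensel.exists_add_map_eq_one_of_isUnit_two` (`t = ⅟2`)
import Mathlib.FieldTheory.Finite.Basic
import Mathlib.NumberTheory.LegendreSymbol.QuadraticChar.Basic
import HarnessLib

/-!
# The norm criterion at a TAMELY RAMIFIED quadratic place: a `σ`-fixed unit is a norm `s·σ(s)` iff its residue is a square
# (Serre, *Local Fields*, Ch. V §3, the totally ramified case: `U_K ∕ N U_L ≅ K̄ˣ ∕ K̄ˣ²` for `ℓ = 2`, `p ≠ 2`; Flicker 1998, Prop. 7 p. 84)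

Topic `NumberTheory/LocalFields`, namespace `Literature.NumberTheory.LocalFields.RamifiedQuadraticNorm`.  THEOREMS ONLY: no definition, no
named fact, no instance, no notation, no `sorry`.  Cell `pub/hodgecm-mathlib` (D-0151), crux H413 = `stmt-HodgeConjecture-24833`, road «R1LL-tree»
(LEAD F0P3a-plan (g10) T9-8 (A); architect A-p16 (g27)), TAME-RAMIFIED design census of B-p12 (g29) `CENSUS-R1LL-tameRamified-LocalClass` §3∕§8
brick **R-3 «norm criterion»**: LEMMA U-ram's normal form `c·(1 + ϖ^i·[[0, ε],[0, 0]])` carries ONE BIT `ε ∈ {1, η}` because at a ramified place the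
`σ`-fixed units are norms only up to INDEX TWO.  This file is the ramified twin of ★ `UnramifiedQuadraticNorm.exists_mul_map_eq_of_finite_residueField`
(«`U_K = N U_L`» at an unramified place).  HC_CM is proved only modulo the printed citations (2 remaining named inputs hLiu418, h413) until rung 0
closes; nothing printed is asserted here — elementary complete-local-ring algebra.

THE PRINT.  [Serre1979, Ch. V §3 Cor. 2 of Prop. 5 and its proof, p. 86 (totally ramified cyclic of prime degree `ℓ`)]: «`N(U_L^{ψ(n)}) = U_K^n` …
`U_K ∕ N U_L` … is cyclic of order `ℓ`» — for `ℓ = 2` and residue characteristic `≠ 2` the norm residue map `N₀ : L̄ˣ = K̄ˣ → K̄ˣ` is `x ↦ x²`, so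
`N U_L = {u ∈ U_K : ū ∈ K̄ˣ²}`.  [Flicker1998UnitaryFL, Prop. 7 p. 84]: the same index-`2` phenomenon for `R + √π R` («`u² − πδ² = 1` implies `u = ±(1 + ⋯)`»).

IN-HOUSE, σ-INTRINSICALLY (currency of ★ F0P2-p06∕B-p04 `RamifiedQuadraticOrderUnitIndex` and ★ `UnramifiedQuadraticNormSurjective`): `R` a LOCAL commutative ring
with a ring involution `σ` (`σσ = id`) which is RESIDUALLY TRIVIAL — `σ x − x ∈ 𝔪` for ALL `x` (the ramified case; the unramified hypothesis «`σ a − a ∈ Rˣ` for some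
`a`» is exactly what fails) — and `2 ∈ Rˣ` (tame).  KEY REMARK: with `2 ∈ Rˣ` the «trace hits `1`» hypothesis of ★ §1 holds for EVERY involution (`t := ⅟2`,
`t + σ t = 1`), so Serre's lifting lemma (★ `exists_mul_map_eq_of_sub_mem`, Ch. V §1 Lemma 2) applies verbatim at a ramified place; only the RESIDUE condition
changes: `σ̄ = id` makes the residue norm `s̄·σ̄(s̄) = s̄²`.

* §1 RESIDUES (no completeness): `residue_map_eq` (`σ̄ = id`), `residue_mul_map_eq_sq` (`N(s)‾ = s̄²`), **`isSquare_residue_of_mul_map_eq`** (a norm has square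
  residue), `exists_fixed_residue_eq` (every residue class has a `σ`-FIXED representative `⅟2·(x + σx)`); the trace identity `t + σt = 1`, `t = ⅟2`,
  is ★ `HermitianFormsHensel.exists_add_map_eq_one_of_isUnit_two` (reused, not restated).
* §2 COMPLETE LOCAL `R` (`[IsAdicComplete 𝔪 R]`): **`exists_mul_map_eq_of_isSquare_residue`** (a `σ`-fixed unit with square residue IS a norm),
  **`exists_mul_map_eq_iff_isSquare_residue`** (THE CRITERION).
* §3 FINITE residue field (then `2 ∈ Rˣ` forces odd characteristic): **`exists_fixed_isUnit_not_exists_mul_map_eq`** (a `σ`-fixed NON-norm unit `η` exists),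
  **`exists_mul_map_eq_or_eq_mul`** (INDEX TWO: every `σ`-fixed unit is `s σs` or `η·s σs`), `exists_mul_map_eq_mul_of_not_of_not` (the product of two
  non-norm `σ`-fixed units is a norm), `exists_mul_mul_map_eq_of_not_of_not` (two non-norm `σ`-fixed units differ by a norm), and the `ω_v`-phrasing
  **`exists_mul_map_eq_iff_quadraticChar_eq_one`** (`u` is a norm ⟺ `ω(ū) = 1`, `ω` = the quadratic character of the residue field).

## References
* [Serre1979] J.-P. Serre, *Local Fields*, GTM 67 (1979), Ch. V §1 Lemma 2, §3 Prop. 5 and Cor. 2–3, pp. 81, 85–86.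
* [Flicker1998UnitaryFL] Y. Z. Flicker, *Elementary proof of the fundamental lemma for a unitary group*, Canad. J. Math. 50 (1998), Prop. 7 p. 84.
-/

set_option autoImplicit false

namespace Literature.NumberTheory.LocalFields.RamifiedQuadraticNorm

open IsLocalRing Literature.NumberTheory.LocalFields.UnramifiedQuadraticNorm

variable {R : Type*} [CommRing R] [IsLocalRing R] (σ : R →+* R)

/-! ## §1 Residues under a residually trivial involution -/

section Residue

/-- A RESIDUALLY TRIVIAL involution (`σ x − x ∈ 𝔪` for all `x`, the ramified case) induces the identity on the residue field: `(σ x)‾ = x̄`.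
[cite: Serre1979, Ch. V §3 (totally ramified: `L̄ = K̄`)] -/
theorem residue_map_eq (hres : ∀ x, σ x - x ∈ maximalIdeal R) (x : R) : residue R (σ x) = residue R x := by
  rw [← sub_eq_zero, ← map_sub, residue_eq_zero_iff]
  exact hres x

/-- Under a residually trivial involution the residue of a norm is a SQUARE: `(s·σ s)‾ = s̄²`.
[cite: Serre1979, Ch. V §3, proof of Prop. 5 (the map `N₀ : x ↦ x^ℓ` on the residue field, `ℓ = 2`)] -/
theorem residue_mul_map_eq_sq (hres : ∀ x, σ x - x ∈ maximalIdeal R) (s : R) : residue R (s * σ s) = residue R s ^ 2 := by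
  rw [map_mul, residue_map_eq σ hres, sq]

/-- NECESSITY of the criterion (no completeness needed): if `u = s·σ s` is a norm then `ū` is a square in the residue field.
[cite: Serre1979, Ch. V §3 Prop. 5 and Cor. 2 (`ℓ = 2`)] [cite: Flicker1998UnitaryFL, Prop. 7 p. 84] -/
theorem isSquare_residue_of_mul_map_eq (hres : ∀ x, σ x - x ∈ maximalIdeal R) {s u : R} (h : s * σ s = u) :
    IsSquare (residue R u) :=
  ⟨residue R s, by rw [← h, residue_mul_map_eq_sq σ hres, sq]⟩

/-- Every residue class has a `σ`-FIXED representative when `2 ∈ Rˣ`: `x' := ⅟2·(x + σ x)` has `σ x' = x'` and `x'‾ = x̄` (residually trivial `σ`).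
[cite: Serre1979, Ch. V §3 (totally ramified: `L̄ = K̄`)] -/
theorem exists_fixed_residue_eq (hσ : ∀ a, σ (σ a) = a) (hres : ∀ x, σ x - x ∈ maximalIdeal R) (h2 : IsUnit (2 : R)) (x : R) :
    ∃ x' : R, σ x' = x' ∧ residue R x' = residue R x := by
  obtain ⟨t, ht⟩ := h2.exists_left_inv
  have hσt : σ t * 2 = 1 := by
    have h := congrArg σ ht
    rwa [map_mul, map_ofNat, map_one] at h
  have htσ : σ t = t := by
    calc σ t = σ t * (t * 2) := by rw [ht, mul_one]
      _ = t * (σ t * 2) := by ring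
      _ = t := by rw [hσt, mul_one]
  refine ⟨t * (x + σ x), ?_, ?_⟩
  · rw [map_mul, map_add, hσ, htσ, add_comm]
  · rw [map_mul, map_add, residue_map_eq σ hres, ← two_mul, ← mul_assoc, ← map_ofNat (residue R) 2, ← map_mul, ht, map_one, one_mul]

end Residue

/-! ## §2 Complete local rings: a `σ`-fixed unit with square residue is a norm (Serre V §1 Lemma 2 with `t = ⅟2`) -/

section Complete

variable [IsAdicComplete (maximalIdeal R) R]

/-- **SUFFICIENCY**: `R` local, complete and separated for `𝔪`, `σ` a residually trivial involution, `2 ∈ Rˣ`; a `σ`-fixed unit `u` whose residue is a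
SQUARE is a norm, `u = s·σ s`.  (Lift `ū = ā²` to `a`; then `u ≡ a·σ a (mod 𝔪)` since `σ̄ = id`, and ★ `exists_mul_map_eq_of_sub_mem` with `t = ⅟2` finishes.)
[cite: Serre1979, Ch. V §1 Lemma 2, §3 Prop. 5 (a) and Cor. 2] [cite: Flicker1998UnitaryFL, Prop. 7 p. 84] -/
theorem exists_mul_map_eq_of_isSquare_residue (hσ : ∀ a, σ (σ a) = a) (hres : ∀ x, σ x - x ∈ maximalIdeal R) (h2 : IsUnit (2 : R))
    {u : R} (hu : IsUnit u) (hσu : σ u = u) (hsq : IsSquare (residue R u)) : ∃ s : R, s * σ s = u := by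
  obtain ⟨t, ht⟩ := Literature.LinearAlgebra.Matrix.HermitianFormsHensel.exists_add_map_eq_one_of_isUnit_two σ h2
  obtain ⟨r, hr⟩ := hsq
  obtain ⟨a, rfl⟩ := residue_surjective r
  have hs₀ : u - a * σ a ∈ maximalIdeal R := by
    rw [← residue_eq_zero_iff, map_sub, hr, residue_mul_map_eq_sq σ hres, sq, sub_self]
  obtain ⟨s, hs, -⟩ := exists_mul_map_eq_of_sub_mem σ hσ (map_mem_maximalIdeal σ hσ) ht hu hσu hs₀
  exact ⟨s, hs⟩

/-- **THE NORM CRITERION AT A TAMELY RAMIFIED PLACE**: `R` local, complete and separated for `𝔪`, `σ` a residually trivial involution, `2 ∈ Rˣ`; a `σ`-fixed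
unit `u` is a norm `s·σ s` if and only if its residue `ū` is a square («`N U_L = U_K ∩ K̄ˣ²`», index `2` when `K̄` is finite of odd characteristic).
[cite: Serre1979, Ch. V §3 Prop. 5 and Cor. 2 (`ℓ = 2`)] [cite: Flicker1998UnitaryFL, Prop. 7 p. 84] -/
theorem exists_mul_map_eq_iff_isSquare_residue (hσ : ∀ a, σ (σ a) = a) (hres : ∀ x, σ x - x ∈ maximalIdeal R) (h2 : IsUnit (2 : R))
    {u : R} (hu : IsUnit u) (hσu : σ u = u) : (∃ s : R, s * σ s = u) ↔ IsSquare (residue R u) :=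
  ⟨fun ⟨_, hs⟩ => isSquare_residue_of_mul_map_eq σ hres hs, exists_mul_map_eq_of_isSquare_residue σ hσ hres h2 hu hσu⟩

end Complete

/-! ## §3 Finite residue field: the non-norm class, index two, and the `ω_v`-phrasing -/

section FiniteResidueField

/-- In a field of characteristic `≠ 2`... concretely in a FINITE field: the product of two non-squares is a square (the squares have index `2` in `kˣ`;
read through the quadratic character `χ(a)χ(b) = (−1)(−1) = 1`). [cite: Serre1979, Ch. V §3 Cor. 2 (`U_K ∕ N U_L` cyclic of order `ℓ = 2`)] -/
private theorem isSquare_mul_of_not_isSquare {k : Type*} [Field k] [Finite k] {a b : k} (ha : ¬ IsSquare a) (hb : ¬ IsSquare b) :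
    IsSquare (a * b) := by
  classical
  haveI := Fintype.ofFinite k
  have ha0 : a ≠ 0 := fun h => ha (h ▸ IsSquare.zero)
  have hb0 : b ≠ 0 := fun h => hb (h ▸ IsSquare.zero)
  rw [← quadraticChar_one_iff_isSquare (mul_ne_zero ha0 hb0), map_mul, quadraticChar_neg_one_iff_not_isSquare.2 ha,
    quadraticChar_neg_one_iff_not_isSquare.2 hb]
  norm_num

/-- `2 ∈ Rˣ` forces the residue field to have characteristic `≠ 2`. [cite: Serre1979, Ch. V §3 (tame: `p ≠ ℓ = 2`)] -/
theorem ringChar_residueField_ne_two (h2 : IsUnit (2 : R)) : ringChar (ResidueField R) ≠ 2 := by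
  intro h
  have h0 : (2 : ResidueField R) = 0 := by
    have := ringChar.Nat.cast_ringChar (R := ResidueField R)
    rw [h] at this
    exact_mod_cast this
  have hu : IsUnit (residue R 2) := h2.map (residue R)
  rw [map_ofNat, h0] at hu
  exact not_isUnit_zero hu

variable [Finite (ResidueField R)]

/-- **The NON-NORM class exists**: `R` local with FINITE residue field, `σ` a residually trivial involution, `2 ∈ Rˣ`; there is a `σ`-FIXED unit `η` which is
NOT a norm `s·σ s` (lift a non-square of the residue field — odd characteristic — to a `σ`-fixed element).  This `η` is the second value of LEMMA U-ram's bit.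
[cite: Serre1979, Ch. V §3 Cor. 2 (`U_K ∕ N U_L` of order `ℓ = 2`)] [cite: Flicker1998UnitaryFL, Prop. 7 p. 84] -/
theorem exists_fixed_isUnit_not_exists_mul_map_eq (hσ : ∀ a, σ (σ a) = a) (hres : ∀ x, σ x - x ∈ maximalIdeal R) (h2 : IsUnit (2 : R)) :
    ∃ η : R, IsUnit η ∧ σ η = η ∧ ¬ IsSquare (residue R η) ∧ ¬ ∃ s : R, s * σ s = η := by
  obtain ⟨a, ha⟩ := FiniteField.exists_nonsquare (ringChar_residueField_ne_two h2)
  obtain ⟨x, rfl⟩ := residue_surjective a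
  obtain ⟨η, hση, hηx⟩ := exists_fixed_residue_eq σ hσ hres h2 x
  rw [← hηx] at ha
  refine ⟨η, ?_, hση, ha, fun ⟨s, hs⟩ => ha (isSquare_residue_of_mul_map_eq σ hres hs)⟩
  rw [← residue_ne_zero_iff_isUnit]
  exact fun h => ha (h ▸ IsSquare.zero)

variable [IsAdicComplete (maximalIdeal R) R]

/-- **INDEX TWO**: `R` local, complete and separated for `𝔪`, residue field FINITE, `σ` a residually trivial involution, `2 ∈ Rˣ`, and `η` a `σ`-fixed
element with NON-square residue; then every `σ`-fixed unit `u` is either a norm `s·σ s` or `η` times a norm (`ū` or `ū·η̄⁻¹` is a square).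
[cite: Serre1979, Ch. V §3 Cor. 2 (`U_K ∕ N U_L` cyclic of order `ℓ = 2`)] [cite: Flicker1998UnitaryFL, Prop. 7 p. 84] -/
theorem exists_mul_map_eq_or_eq_mul (hσ : ∀ a, σ (σ a) = a) (hres : ∀ x, σ x - x ∈ maximalIdeal R) (h2 : IsUnit (2 : R))
    {η : R} (hση : σ η = η) (hη : ¬ IsSquare (residue R η)) {u : R} (hu : IsUnit u) (hσu : σ u = u) :
    ∃ s : R, s * σ s = u ∨ η * (s * σ s) = u := by
  by_cases hsq : IsSquare (residue R u)
  · obtain ⟨s, hs⟩ := exists_mul_map_eq_of_isSquare_residue σ hσ hres h2 hu hσu hsq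
    exact ⟨s, Or.inl hs⟩
  · have hηu : IsUnit η := by
      rw [← residue_ne_zero_iff_isUnit]
      exact fun h => hη (h ▸ IsSquare.zero)
    obtain ⟨ηi, hηi⟩ := hηu.exists_left_inv
    have hσηi : σ ηi = ηi := by
      have h1 : σ ηi * η = 1 := by
        have h := congrArg σ hηi
        rwa [map_mul, hση, map_one] at h
      calc σ ηi = σ ηi * (ηi * η) := by rw [hηi, mul_one]
        _ = ηi * (σ ηi * η) := by ring
        _ = ηi := by rw [h1, mul_one]
    have hηires : ¬ IsSquare (residue R ηi) := by
      intro hi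
      apply hη
      have hprod : residue R ηi * residue R η = 1 := by rw [← map_mul, hηi, map_one]
      rw [eq_inv_of_mul_eq_one_right hprod]
      exact isSquare_inv.2 hi
    have hv : IsUnit (u * ηi) := hu.mul (isUnit_iff_exists_inv.2 ⟨η, hηi⟩)
    have hσv : σ (u * ηi) = u * ηi := by rw [map_mul, hσu, hσηi]
    have hvsq : IsSquare (residue R (u * ηi)) := by
      rw [map_mul]
      exact isSquare_mul_of_not_isSquare hsq hηires
    obtain ⟨s, hs⟩ := exists_mul_map_eq_of_isSquare_residue σ hσ hres h2 hv hσv hvsq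
    refine ⟨s, Or.inr ?_⟩
    rw [hs, mul_comm η, mul_assoc, hηi, mul_one]

/-- The PRODUCT of two `σ`-fixed NON-norm units is a norm (the norm subgroup has index `2` in the `σ`-fixed units).
[cite: Serre1979, Ch. V §3 Cor. 2 (`ℓ = 2`)] -/
theorem exists_mul_map_eq_mul_of_not_of_not (hσ : ∀ a, σ (σ a) = a) (hres : ∀ x, σ x - x ∈ maximalIdeal R) (h2 : IsUnit (2 : R))
    {u₁ u₂ : R} (hu₁ : IsUnit u₁) (hσu₁ : σ u₁ = u₁) (h₁ : ¬ ∃ s : R, s * σ s = u₁)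
    (hu₂ : IsUnit u₂) (hσu₂ : σ u₂ = u₂) (h₂ : ¬ ∃ s : R, s * σ s = u₂) : ∃ s : R, s * σ s = u₁ * u₂ := by
  have h₁' : ¬ IsSquare (residue R u₁) := fun h => h₁ (exists_mul_map_eq_of_isSquare_residue σ hσ hres h2 hu₁ hσu₁ h)
  have h₂' : ¬ IsSquare (residue R u₂) := fun h => h₂ (exists_mul_map_eq_of_isSquare_residue σ hσ hres h2 hu₂ hσu₂ h)
  refine exists_mul_map_eq_of_isSquare_residue σ hσ hres h2 (hu₁.mul hu₂) (by rw [map_mul, hσu₁, hσu₂]) ?_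
  rw [map_mul]
  exact isSquare_mul_of_not_isSquare h₁' h₂'

/-- Two `σ`-fixed NON-norm units DIFFER BY A NORM: `η₁ = η₂·(s·σ s)` — the bit of LEMMA U-ram is well defined (any non-norm `η` serves).
[cite: Serre1979, Ch. V §3 Cor. 2 (`ℓ = 2`)] [cite: Flicker1998UnitaryFL, Prop. 7 p. 84] -/
theorem exists_mul_mul_map_eq_of_not_of_not (hσ : ∀ a, σ (σ a) = a) (hres : ∀ x, σ x - x ∈ maximalIdeal R) (h2 : IsUnit (2 : R))
    {η₁ η₂ : R} (hu₁ : IsUnit η₁) (hσ₁ : σ η₁ = η₁) (h₁ : ¬ ∃ s : R, s * σ s = η₁)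
    (hσ₂ : σ η₂ = η₂) (h₂ : ¬ IsSquare (residue R η₂)) : ∃ s : R, η₂ * (s * σ s) = η₁ := by
  obtain ⟨s, hs | hs⟩ := exists_mul_map_eq_or_eq_mul σ hσ hres h2 hσ₂ h₂ hu₁ hσ₁
  · exact absurd ⟨s, hs⟩ h₁
  · exact ⟨s, hs⟩

omit [Finite (ResidueField R)] in
/-- **The `ω_v`-phrasing of the criterion** (B-p12's census: «a `σ`-fixed unit `r` is a norm `λσλ` iff `ω_v(r̄) = 1`»): `R` local, complete and separated
for `𝔪`, residue field finite, `σ` a residually trivial involution, `2 ∈ Rˣ`; a `σ`-fixed unit `u` is a norm iff the QUADRATIC CHARACTER of the residue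
field takes the value `1` at `ū`. [cite: Serre1979, Ch. V §3 Prop. 5 and Cor. 2 (`ℓ = 2`)] [cite: Flicker1998UnitaryFL, Prop. 7 p. 84] -/
theorem exists_mul_map_eq_iff_quadraticChar_eq_one [Fintype (ResidueField R)] [DecidableEq (ResidueField R)]
    (hσ : ∀ a, σ (σ a) = a) (hres : ∀ x, σ x - x ∈ maximalIdeal R) (h2 : IsUnit (2 : R)) {u : R} (hu : IsUnit u) (hσu : σ u = u) :
    (∃ s : R, s * σ s = u) ↔ quadraticChar (ResidueField R) (residue R u) = 1 := by
  rw [exists_mul_map_eq_iff_isSquare_residue σ hσ hres h2 hu hσu,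
    quadraticChar_one_iff_isSquare ((residue_ne_zero_iff_isUnit u).2 hu)]

end FiniteResidueField

end Literature.NumberTheory.LocalFields.RamifiedQuadraticNorm
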